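import Literature.AlgebraicGeometry.Resolution.BlowupReesChartDictionary
import Literature.AlgebraicGeometry.Modules.SerreTwistHom
import Literature.AlgebraicGeometry.Modules.IdealMulMaps
import Literature.AlgebraicGeometry.Modules.IsoOfSectionsOnBasis
import Literature.AlgebraicGeometry.Modules.SheafHomLeft
import HarnessLib

/-!
# The twist evaluation `Φ_n : G(n) ⟶ G` on a Rees-embedded blowing up, and `G(n) ≅ (J𝒪)ⁿ·G` for
# exceptional-torsion-free `G`

Topic: `Literature/AlgebraicGeometry/Resolution`. PROVED, fact-free (plumbing definitions `sheafHomEvalAt`,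
`twistPowSection`, `twistEval`, `twistEvalLift`, `chartAffineBasis`, all docstringed; no
named fact). Step S6b of the F-53 route (δ) «domination + divisorial twist» (D-0154 (2) RES inputs cell, seats
res-inputs-p-9b / res-inputs-p-9c), between the chart dictionary (`BlowupReesChartDictionary.lean`:
`reesEmbedding c : Bl_J(Spec B) ↪ 𝐏ᵐ_B`, `chartFun_reesEmbedding_mul_pull : (x_i/x_j)·c_j = c_i` on `Z_j`)
and the local Serre-vanishing lemma (`BlowupSerreVanishingLocal.lean`), which needs Serre's vanishing
`Ȟ¹(G(n)) = 0` (tree `SerreVanishingTwist`, stated for the tree's twist `twistMod ι G n`) in the form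
`Ȟ¹((J𝒪)ⁿ·G) = 0`.

THE MATHEMATICS (Hartshorne II Prop. 5.12 (c), II Prop. 7.13 (a) and its proof; Liu Prop. 8.1.12 (e)). Let
`J = (c₀, …, c_m) ⊆ B`, `ι = reesEmbedding c : Bl := Bl_J(Spec B) ↪ 𝐏ᵐ_B`, `Z_j = ι⁻¹D₊(T_j) = D₊(c_j t)`.
The tree's twist `G(n) = twistMod ι G n` of an `𝒪_{Bl}`-module `G` has sections over `V` the families
`(x_j)_j`, `x_j ∈ Γ(V ∩ Z_j, G)`, with `x_{j′} = (x_j/x_{j′})ⁿ x_j`; and `𝒪_{Bl}(1) = J·𝒪_{Bl}`, on `Z_j`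
generated by `c_j` (`ideal_exceptionalIdeal_of_le`). The family `(c_w)_w = (c_{w₁}⋯c_{w_n})_w` is a global
section `σ_n` of `𝒪(-n) = serreTwist ι n` (`twistPowSection`; the cocycle condition is the chart dictionary),
and evaluating `G(n) ≅ 𝓗om(𝒪(-n), G)` (tree `sheafHomTwistIso`) at `σ_n` gives
**`Φ_n : G(n) ⟶ G`, `(x_j)_j ↦ c_jⁿ · x_j` on `V ⊆ Z_j`** (`twistEval`, `twistEval_app_of_le`). Its values are
sections of `(J𝒪)ⁿ·G` (`twistEvalLift : G(n) ⟶ idealMul G (J𝒪)ⁿ`), and **for `G` affine-localizing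
(quasi-coherent) without `J𝒪`-torsion on affine opens, `Φ_n : G(n) ≅ (J𝒪)ⁿ·G`** (`isIso_twistEvalLift`):
on an affine `W ⊆ Z_j` it is injective because `c_j` is `G(W)`-regular and surjective because
`((J𝒪)ⁿ·G)(W) = c_jⁿ·G(W)`; these `W` form a basis (`isBasis_chartAffineBasis`), and a morphism of sheaves
bijective on a basis is an isomorphism (tree `isIso_of_bijective_app_of_mem_basis`). Consequently
`Ȟ¹(𝒰; G(n)) = 0 ⟹ Ȟ¹(𝒰; (J𝒪)ⁿ·G) = 0` for every family `𝒰` (`subsingleton_cechMH1_idealMul_pow_of_twistMod`).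

No step of any summit is discharged here; `GortzWedhorn2023_24_44_H2` and the F-53 door stay PRINT.
AI-written; AI review is weaker than expert review.

## References
* R. Hartshorne, *Algebraic Geometry*, GTM 52 (1977), II Prop. 5.12 (c) (p. 117: twists under a morphism of
  `Proj`'s), II Prop. 7.13 (a) and its proof (`π⁻¹𝓘·𝒪_X̃ = 𝒪(1)` on the blowing up), III Thm. 5.2 (b)
  (p. 228). [Hartshorne1977]
* Q. Liu, *Algebraic Geometry and Arithmetic Curves* (2002), Prop. 8.1.12 (e) (`I·𝒪_X̃ = 𝒪_X̃(1)`, p. 380),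
  Lemma 8.1.2 (e). [Liu2002]
* The Stacks Project, Tags 0804, 02OS (blowing up: affine charts and the exceptional ideal). [StacksProject]
-/

noncomputable section

universe u

open CategoryTheory AlgebraicGeometry TopologicalSpace Opposite HomogeneousLocalization MvPolynomial
open Literature.Algebra.Homology Literature.Algebra.Homology.LaurentCech
open Literature.AlgebraicGeometry.Morphisms Literature.AlgebraicGeometry.Morphisms.ProjCech
open Literature.AlgebraicGeometry.Modules Literature.AlgebraicGeometry.Modules.SerreTwist

attribute [local instance] MvPolynomial.gradedAlgebra
  Literature.AlgebraicGeometry.Motives.ProjBaseChange.algebraBase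

namespace Literature.AlgebraicGeometry.Resolution

variable {B : Type u} [CommRing B] {m : ℕ} (c : Fin (m + 1) → B)

local notation3 "𝓘" => Ideal.span (Set.range c)

/-! ## Evaluation of `𝓗om(E, M)` at a global section -/

section EvalAt

variable {X : Scheme.{u}} {E M : X.Modules}

/-- **Evaluation of `𝓗om(E, M)` at a global section `σ` of `E`**: the morphism of `𝒪_X`-modules
`𝓗om(E, M) ⟶ M`, `ψ ↦ ψ(σ|_U)` on sections over `U`. [folklore] -/
def sheafHomEvalAt (σ : Γ(E, ⊤)) : sheafHom E M ⟶ M where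
  val := PresheafOfModules.homMk
    { app := fun U => AddCommGrpCat.ofHom
        { toFun := fun ψ => appLE (show E.over U.unop ⟶ M.over U.unop from ψ) (𝟙 U.unop)
            (E.presheaf.map (homOfLE (le_top : U.unop ≤ ⊤)).op σ)
          map_zero' := appLE_zero _ _
          map_add' := fun ψ ψ' => appLE_add _ _ _ _ }
      naturality := fun {U V} g => by
        ext ψ
        change appLE (restrictHom g.unop (show E.over U.unop ⟶ M.over U.unop from ψ)) (𝟙 V.unop)
            (E.presheaf.map (homOfLE (le_top : V.unop ≤ ⊤)).op σ) =
          M.presheaf.map g (appLE (show E.over U.unop ⟶ M.over U.unop from ψ) (𝟙 U.unop)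
            (E.presheaf.map (homOfLE (le_top : U.unop ≤ ⊤)).op σ))
        have hg : g = (homOfLE g.unop.le).op := Subsingleton.elim _ _
        have hσ : E.presheaf.map (homOfLE (le_top : V.unop ≤ ⊤)).op σ =
            E.presheaf.map (homOfLE g.unop.le).op (E.presheaf.map (homOfLE (le_top : U.unop ≤ ⊤)).op σ) := by
          rw [presheaf_map_map]
          rfl
        rw [appLE_restrictHom, hσ, hg, ← appLE_map]
        exact Literature.AlgebraicGeometry.Modules.appLE_congr_hom _ _ _ _ }
    (fun U a ψ => by
      refine (appLE_smul (show Γ(X, U.unop) from a) (show E.over U.unop ⟶ M.over U.unop from ψ)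
        (𝟙 U.unop) _).trans ?_
      rw [op_id, X.presheaf.map_id]
      rfl)

/-- Values of the evaluation morphism `𝓗om(E, M) ⟶ M` at `σ`. [cite: Hartshorne1977, II Ex. 1.15 and II.5 p. 109] -/
theorem sheafHomEvalAt_app (σ : Γ(E, ⊤)) (U : X.Opens) (ψ : Γ(sheafHom E M, U)) :
    (sheafHomEvalAt σ).app U ψ =
      appLE (show E.over U ⟶ M.over U from ψ) (𝟙 U) (E.presheaf.map (homOfLE (le_top : U ≤ ⊤)).op σ) :=
  rfl

end EvalAt

/-! ## The twist section `(c_w)_w ∈ Γ(Bl, 𝒪(-n))` of the Rees embedding -/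

/-- The pull-back of functions `B → Γ(Bl, W)` is a ring homomorphism. [folklore] -/
private def pullHom (W : (affineBlowup (Ideal.span (Set.range c))).Opens) :
    B →+* Γ(affineBlowup (Ideal.span (Set.range c)), W) :=
  ((affineBlowup.π 𝓘).appLE ⊤ W le_top).hom.comp (Scheme.ΓSpecIso (.of B)).inv.hom

/-- `pullHom W a = affineBlowup.pull J W a` (rfl). [folklore] -/
private theorem pullHom_apply (W : (affineBlowup (Ideal.span (Set.range c))).Opens) (a : B) :
    pullHom c W a = affineBlowup.pull 𝓘 W a := rfl

/-- Restriction of pulled-back functions `B → Γ(Bl, W) → Γ(Bl, V)`. [cite: StacksProject, Tag 0804] -/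
theorem map_pull {W V : (affineBlowup (Ideal.span (Set.range c))).Opens} (h : V ≤ W) (a : B) :
    (affineBlowup (Ideal.span (Set.range c))).presheaf.map (homOfLE h).op (affineBlowup.pull 𝓘 W a) =
      affineBlowup.pull 𝓘 V a := by
  change ((affineBlowup.π 𝓘).appLE ⊤ W le_top ≫
      (affineBlowup (Ideal.span (Set.range c))).presheaf.map (homOfLE h).op) _ = _
  rw [Scheme.Hom.appLE_map]

/-- **The chart dictionary restricted to an open `V ⊆ Z_j`**: `(x_i/x_j)|_V · c_j|_V = c_i|_V`.
[cite: Liu2002, Lemma 8.1.2 (e)] -/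
theorem map_chartFun_reesEmbedding_mul_pull {V : (affineBlowup (Ideal.span (Set.range c))).Opens}
    {j : Fin (m + 1)} (hV : V ≤ Zop (reesEmbedding c) {j}) (i : Fin (m + 1)) :
    (affineBlowup (Ideal.span (Set.range c))).presheaf.map (homOfLE hV).op (chartFun (reesEmbedding c) i j) *
        affineBlowup.pull 𝓘 V (c j) = affineBlowup.pull 𝓘 V (c i) := by
  rw [← map_pull c hV (c j), ← map_pull c hV (c i), ← map_mul, chartFun_reesEmbedding_mul_pull]

/-- The family `w ↦ c_w := c_{w 0} ⋯ c_{w (n-1)}` (pulled back to `Bl`) is a section of `𝒪_{Bl}(-n)`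
for the Rees embedding: `c_w · μ_{w'}/x_j^n = c_{w'} · μ_w/x_j^n` on `Z_j`, by the chart dictionary.
[cite: Hartshorne1977, II Prop. 7.13 (a) and proof] -/
theorem isTwistSection_pull_prod (n : ℕ) :
    IsTwistSection (reesEmbedding c) n ⊤
      fun w : Fin n → Fin (m + 1) => affineBlowup.pull 𝓘 ⊤ (∏ t, c (w t)) := by
  intro j w w' V hV hj
  -- restrict everything to `V`
  have hres : ∀ v : Fin n → Fin (m + 1),
      (affineBlowup (Ideal.span (Set.range c))).presheaf.map (homOfLE hV).op
          (affineBlowup.pull 𝓘 ⊤ (∏ t, c (v t))) =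
        ∏ t, ((affineBlowup (Ideal.span (Set.range c))).presheaf.map (homOfLE hj).op
            (chartFun (reesEmbedding c) (v t) j) * affineBlowup.pull 𝓘 V (c j)) := by
    intro v
    rw [map_pull c hV, ← pullHom_apply, map_prod]
    refine Finset.prod_congr rfl fun t _ => ?_
    rw [pullHom_apply, map_chartFun_reesEmbedding_mul_pull c hj]
  have hword : ∀ v : Fin n → Fin (m + 1),
      (affineBlowup (Ideal.span (Set.range c))).presheaf.map (homOfLE hj).op (wordFun (reesEmbedding c) j v) =
        ∏ t, (affineBlowup (Ideal.span (Set.range c))).presheaf.map (homOfLE hj).op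
          (chartFun (reesEmbedding c) (v t) j) := by
    intro v
    rw [wordFun, map_prod]
  rw [hres w, hres w', hword w, hword w', Finset.prod_mul_distrib, Finset.prod_mul_distrib]
  ring

/-- **The twist section `σ_n = (c_w)_w ∈ Γ(Bl, 𝒪_{Bl}(-n))`** of the Rees embedding.
Plumbing definition. [folklore] -/
def twistPowSection (n : ℕ) : Γ(serreTwist (reesEmbedding c) n, ⊤) :=
  mkSection (reesEmbedding c) _ (isTwistSection_pull_prod c n)

/-- The `j⋯j`-coordinate of `σ_n` restricted to `V` is `c_j^n|_V`. [cite: Hartshorne1977, II Prop. 5.12 (c)] -/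
theorem coeff_map_twistPowSection_const (n : ℕ) {V : (affineBlowup (Ideal.span (Set.range c))).Opens}
    (j : Fin (m + 1)) :
    coeff (reesEmbedding c) ((serreTwist (reesEmbedding c) n).presheaf.map (homOfLE (le_top : V ≤ ⊤)).op
      (twistPowSection c n)) (fun _ => j) = affineBlowup.pull 𝓘 V (c j) ^ n := by
  rw [SerreTwist.coeff_map, twistPowSection, coeff_mkSection, Finset.prod_const, Finset.card_univ, Fintype.card_fin,
    map_pull, ← pullHom_apply, map_pow]
  rfl

/-! ## The evaluation morphism `Φ_n : G(n) ⟶ G`, `(n_j)_j ↦ (c_j^n · n_j on Z_j)` -/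

variable (G : (affineBlowup (Ideal.span (Set.range c))).Modules) (n : ℕ)

/-- **The evaluation morphism `Φ_n : G(n) = twistMod ι G n ⟶ G`** for the Rees embedding
`ι : Bl_J(Spec B) ↪ 𝐏ᵐ_B`: through `G(n) ≅ 𝓗om(𝒪(-n), G)` (`sheafHomTwistIso`), evaluate at the
twist section `σ_n = (c_w)_w`. On `V ⊆ Z_j` it sends a twist family `(n_{j′})` to `c_jⁿ · n_j`.
Plumbing definition. [folklore] -/
def twistEval : twistMod (reesEmbedding c) G n ⟶ G :=
  (sheafHomTwistIso (reesEmbedding c) G n).inv ≫ sheafHomEvalAt (twistPowSection c n)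

/-- **Values of `Φ_n` on a chart**: for `V ⊆ Z_j` and a twist family `x = (x_{j′})_{j′}` over `V`,
`Φ_n(x) = c_jⁿ · x_j`. [cite: Hartshorne1977, II Prop. 5.12 (c)] -/
theorem twistEval_app_of_le {V : (affineBlowup (Ideal.span (Set.range c))).Opens} {j : Fin (m + 1)}
    (hV : V ≤ Zop (reesEmbedding c) {j}) (x : Γ(twistMod (reesEmbedding c) G n, V)) :
    (twistEval c G n).app V x =
      affineBlowup.pull 𝓘 V (c j) ^ n •
        G.presheaf.map (homOfLE (le_inf le_rfl hV : V ≤ V ⊓ Zop (reesEmbedding c) {j})).op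
          (comp (reesEmbedding c) G x j) := by
  let ι := reesEmbedding c
  let ψ : (serreTwist ι n).over V ⟶ G.over V :=
    show (serreTwist ι n).over V ⟶ G.over V from (sheafHomTwistIso ι G n).inv.app V x
  have hx : (homToTwist ι G n).app V ψ = x := by
    change ((sheafHomTwistIso ι G n).inv ≫ (sheafHomTwistIso ι G n).hom).app V x = x
    rw [Iso.inv_hom_id]
    rfl
  have hfam : homFamily ι G n ψ j = comp ι G x j := by
    rw [← hx]
    rfl
  unfold twistEval
  rw [Scheme.Modules.Hom.comp_app]
  change (sheafHomEvalAt (twistPowSection c n)).app V ψ = _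
  rw [sheafHomEvalAt_app, appLE_eq_coeff_smul ι G n ψ (le_inf le_rfl hV) (𝟙 V),
    coeff_map_twistPowSection_const, hfam]


/-! ## `G(n) ≅ (J𝒪)ⁿ · G` for an exceptional-torsion-free `G` -/

section TwistIdealMulIso

variable {c}

/-- On an affine open `V ⊆ Z_j` the exceptional ideal is generated by `c_j|_V`.
[cite: StacksProject, Tag 02OS] -/
theorem ideal_exceptionalIdeal_of_le {V : (affineBlowup (Ideal.span (Set.range c))).affineOpens}
    {j : Fin (m + 1)} (hV : (V : (affineBlowup (Ideal.span (Set.range c))).Opens) ≤ Zop (reesEmbedding c) {j}) :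
    (affineBlowup.exceptionalIdeal 𝓘).ideal V = Ideal.span {affineBlowup.pull 𝓘 V (c j)} := by
  have hle : V ≤ affineBlowup.chartOpen (I := 𝓘) (c j) (Ideal.mem_span_range_self (f := c) (x := j)) := by
    change (V : (affineBlowup (Ideal.span (Set.range c))).Opens) ≤ _
    rw [← Zop_reesEmbedding]
    exact hV
  rw [← Scheme.IdealSheafData.map_ideal _ hle, affineBlowup.ideal_exceptionalIdeal_chartOpen,
    Ideal.map_span, Set.image_singleton]
  exact congrArg (fun t => Ideal.span {t}) (map_pull c hle (c j))

/-- On an affine open `V ⊆ Z_j`, the `n`-th power of the exceptional ideal is generated by `c_jⁿ|_V`.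
[cite: StacksProject, Tag 02OS] -/
theorem ideal_exceptionalIdeal_pow_of_le (n : ℕ) {V : (affineBlowup (Ideal.span (Set.range c))).affineOpens}
    {j : Fin (m + 1)} (hV : (V : (affineBlowup (Ideal.span (Set.range c))).Opens) ≤ Zop (reesEmbedding c) {j}) :
    (affineBlowup.exceptionalIdeal 𝓘 ^ n).ideal V = Ideal.span {affineBlowup.pull 𝓘 V (c j) ^ n} := by
  rw [Scheme.IdealSheafData.ideal_pow, Pi.pow_apply, ideal_exceptionalIdeal_of_le hV, Ideal.span_singleton_pow]

variable (G : (affineBlowup (Ideal.span (Set.range c))).Modules) (n : ℕ)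

-- The EXCEPTIONAL-TORSION-FREENESS hypothesis `htf` below (spelled out at each use, no definition): `G` has
-- no non-zero section over an affine open killed by the exceptional ideal `J·𝒪_{Bl}`.
variable {G n}

/-- Cancellation of `c_jᵏ` on affine opens `V ⊆ Z_j` for an exceptional-torsion-free `G`.
[cite: StacksProject, Tag 02OS] -/
theorem eq_zero_of_pull_pow_smul_eq_zero
    (htf : ∀ (V : (affineBlowup (Ideal.span (Set.range c))).Opens) (hV : IsAffineOpen V) (q : Γ(G, V)),
      (∀ a ∈ (affineBlowup.exceptionalIdeal 𝓘).ideal ⟨V, hV⟩, a • q = 0) → q = 0)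
    {V : (affineBlowup (Ideal.span (Set.range c))).Opens} (hVaff : IsAffineOpen V) {j : Fin (m + 1)}
    (hV : V ≤ Zop (reesEmbedding c) {j}) (k : ℕ) (q : Γ(G, V))
    (hq : affineBlowup.pull 𝓘 V (c j) ^ k • q = 0) : q = 0 := by
  induction k generalizing q with
  | zero => rwa [pow_zero, one_smul] at hq
  | succ k ih =>
    apply ih
    apply htf V hVaff
    intro a ha
    rw [ideal_exceptionalIdeal_of_le (V := ⟨V, hVaff⟩) hV, Ideal.mem_span_singleton] at ha
    obtain ⟨b, rfl⟩ := ha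
    rw [mul_comm, mul_smul, ← mul_smul (affineBlowup.pull 𝓘 V (c j)), ← pow_succ', hq, smul_zero]

variable (G n)

/-- The values of `Φ_n` are `(J𝒪)ⁿ`-product sections: locally `c_jⁿ · x_j`. [cite: Hartshorne1977, II Prop. 5.12 (c)] -/
theorem isIdealMulSection_twistEval_app (V : (affineBlowup (Ideal.span (Set.range c))).Opens)
    (x : Γ(twistMod (reesEmbedding c) G n, V)) :
    IsIdealMulSection G (affineBlowup.exceptionalIdeal 𝓘 ^ n) V ((twistEval c G n).app V x) := by
  intro y hy
  -- `y` lies in some chart `Z_j`; take an affine neighbourhood inside `V ∩ Z_j`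
  have hyU : y ∈ (⨆ j : Fin (m + 1), V ⊓ Zop (reesEmbedding c) {j} :
      (affineBlowup (Ideal.span (Set.range c))).Opens) := le_iSup_inf_Zop (reesEmbedding c) V hy
  obtain ⟨j, hyj⟩ := Opens.mem_iSup.mp hyU
  obtain ⟨W, hW, hyW, hWle⟩ := Opens.isBasis_iff_nbhd.mp
    (affineBlowup (Ideal.span (Set.range c))).isBasis_affineOpens hyj
  have hWV : W ≤ V := hWle.trans inf_le_left
  have hWj : W ≤ Zop (reesEmbedding c) {j} := hWle.trans inf_le_right
  refine ⟨⟨W, hW⟩, hWV, hyW, ?_⟩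
  change G.presheaf.map (homOfLE hWV).op ((twistEval c G n).app V x) ∈ _
  rw [← app_presheaf_map, twistEval_app_of_le c G n hWj, ideal_exceptionalIdeal_pow_of_le n (V := ⟨W, hW⟩) hWj]
  exact Submodule.smul_mem_smul (Ideal.mem_span_singleton_self _) Submodule.mem_top

/-- **`Φ_n` lifted to `G(n) ⟶ (J𝒪)ⁿ · G`.** Plumbing definition. [folklore] -/
def twistEvalLift : twistMod (reesEmbedding c) G n ⟶ idealMul G (affineBlowup.exceptionalIdeal 𝓘 ^ n) :=
  idealMulLift (twistEval c G n) (isIdealMulSection_twistEval_app G n)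

/-- The basis of affine opens contained in some chart `Z_j`. [folklore] -/
def chartAffineBasis : Set (affineBlowup (Ideal.span (Set.range c))).Opens :=
  {W | IsAffineOpen W ∧ ∃ j : Fin (m + 1), W ≤ Zop (reesEmbedding c) {j}}

/-- Affine opens inside the charts form a basis of `Bl_J(Spec B)`. [cite: StacksProject, Tag 0804] -/
theorem isBasis_chartAffineBasis : Opens.IsBasis (chartAffineBasis (c := c)) := by
  refine Opens.isBasis_iff_nbhd.mpr fun {U y} hy => ?_
  have hyU : y ∈ (⨆ j : Fin (m + 1), U ⊓ Zop (reesEmbedding c) {j} :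
      (affineBlowup (Ideal.span (Set.range c))).Opens) := le_iSup_inf_Zop (reesEmbedding c) U hy
  obtain ⟨j, hyj⟩ := Opens.mem_iSup.mp hyU
  obtain ⟨W, hW, hyW, hWle⟩ := Opens.isBasis_iff_nbhd.mp
    (affineBlowup (Ideal.span (Set.range c))).isBasis_affineOpens hyj
  exact ⟨W, ⟨hW, j, hWle.trans inf_le_right⟩, hyW, hWle.trans inf_le_left⟩

variable {G n}

/-- **On an affine open `W ⊆ Z_j`, `Φ_n` is bijective onto `(J𝒪)ⁿ · G`** for `G` affine-localizing and
exceptional-torsion-free: injective since `c_j` is `G`-regular there, surjective since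
`((J𝒪)ⁿ·G)(W) = c_jⁿ · G(W)`. [cite: Hartshorne1977, II Prop. 5.12 (c)] -/
theorem twistEvalLift_app_bijective_of_mem (hG : IsAffineLocalizing G)
    (htf : ∀ (V : (affineBlowup (Ideal.span (Set.range c))).Opens) (hV : IsAffineOpen V) (q : Γ(G, V)),
      (∀ a ∈ (affineBlowup.exceptionalIdeal 𝓘).ideal ⟨V, hV⟩, a • q = 0) → q = 0)
    {W : (affineBlowup (Ideal.span (Set.range c))).Opens} (hW : W ∈ chartAffineBasis (c := c)) :
    Function.Bijective ((twistEvalLift G n).app W) := by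
  obtain ⟨hWaff, j, hWj⟩ := hW
  have hval : ∀ x : Γ(twistMod (reesEmbedding c) G n, W),
      (idealMulι G _).app W ((twistEvalLift G n).app W x) =
        affineBlowup.pull 𝓘 W (c j) ^ n • chartEquiv (reesEmbedding c) G n hWj x := by
    intro x
    have h1 := idealMulι_app_idealMulLift_app (twistEval c G n) (isIdealMulSection_twistEval_app G n) W x
    rw [twistEval_app_of_le c G n hWj, ← chartEquiv_apply] at h1
    exact h1
  constructor
  · intro x x' hxx'
    have h := congrArg ((idealMulι G (affineBlowup.exceptionalIdeal 𝓘 ^ n)).app W) hxx'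
    rw [hval, hval, ← sub_eq_zero, ← smul_sub, ← map_sub] at h
    have h0 := eq_zero_of_pull_pow_smul_eq_zero htf hWaff hWj n _ h
    rw [map_eq_zero_iff _ (chartEquiv (reesEmbedding c) G n hWj).injective, sub_eq_zero] at h0
    exact h0
  · intro s
    have hs := idealMulι_app_mem hG hWaff s
    rw [ideal_exceptionalIdeal_pow_of_le n (V := ⟨W, hWaff⟩) hWj, Submodule.ideal_span_singleton_smul,
      Submodule.mem_smul_pointwise_iff_exists] at hs
    obtain ⟨y, -, hy⟩ := hs
    refine ⟨(chartEquiv (reesEmbedding c) G n hWj).symm y, ?_⟩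
    apply idealMulι_app_injective
    rw [hval, LinearEquiv.apply_symm_apply, hy]

/-- **`Φ_n : G(n) ⟶ (J𝒪)ⁿ · G` is an isomorphism** for `G` affine-localizing and exceptional-torsion-free
(bijective on the basis of affine opens inside the charts; `isIso_of_bijective_on_basis`).
[cite: Hartshorne1977, II Prop. 5.12 (c)] -/
theorem isIso_twistEvalLift (hG : IsAffineLocalizing G)
    (htf : ∀ (V : (affineBlowup (Ideal.span (Set.range c))).Opens) (hV : IsAffineOpen V) (q : Γ(G, V)),
      (∀ a ∈ (affineBlowup.exceptionalIdeal 𝓘).ideal ⟨V, hV⟩, a • q = 0) → q = 0) :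
    IsIso (twistEvalLift G n) :=
  isIso_of_bijective_on_basis _ isBasis_chartAffineBasis fun _ hW =>
    twistEvalLift_app_bijective_of_mem hG htf hW

/-- **`Ȟ¹(𝒰; G(n)) = 0 ⟹ Ȟ¹(𝒰; (J𝒪)ⁿ·G) = 0`** for any family `𝒰` and any structure map (transport along
the isomorphism `Φ_n`). [cite: Hartshorne1977, III Thm. 5.2 (b)] -/
theorem subsingleton_cechMH1_idealMul_pow_of_twistMod (hG : IsAffineLocalizing G)
    (htf : ∀ (V : (affineBlowup (Ideal.span (Set.range c))).Opens) (hV : IsAffineOpen V) (q : Γ(G, V)),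
      (∀ a ∈ (affineBlowup.exceptionalIdeal 𝓘).ideal ⟨V, hV⟩, a • q = 0) → q = 0)
    {A' : Type u} [CommRing A'] (f : affineBlowup (Ideal.span (Set.range c)) ⟶ Spec (.of A'))
    {κ : Type*} (T : κ → (affineBlowup (Ideal.span (Set.range c))).Opens)
    (h : Subsingleton (CechMH1 f (twistMod (reesEmbedding c) G n) T)) :
    Subsingleton (CechMH1 f (idealMul G (affineBlowup.exceptionalIdeal 𝓘 ^ n)) T) :=
  haveI := isIso_twistEvalLift (n := n) hG htf
  subsingleton_cechMH1_of_iso f T (asIso (twistEvalLift G n)).symm h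

end TwistIdealMulIso

end Literature.AlgebraicGeometry.Resolution

end
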